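import Literature.Analysis.FluidPDE.KatoLaiBilinearExt
import HarnessLib

/-!
# Kato–Lai in the periodic cylinder: time regularity of the level readings of the solution

Analysis/FluidPDE support file for the energy-method construction of Euler flows in the
periodic cylinder (`Literature.Analysis.FluidPDE.KatoLai1984_periodicCylinderUniformExistence`;
Kato–Lai 1984, Thm I `u ∈ C(I; H^s_σ)`, and the standard bootstrap `u ∈ C^l(I; H^{s−l})` from
`dₜu = −A(u)` with `A : H^{m+1} → H^m` bounded quadratic). For a coefficient path `G` carried by
consecutive windows of solutions in duality form of the level-`s` problem (`IsWindowed`), the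
level-`m` readings `F_m t = levRead m (G t)` satisfy:

* `hasDerivWithinAt_of_dense_inner` — the abstract tool: a continuous Hilbert-space path whose
  pairings with a dense set of vectors have the derivative `⟪v, b t⟫`, `b` continuous, has the
  derivative `b t`;
* `IsWindowed.continuousOn_levRead` — `F_m` is continuous on `[0, T]` for `m < s`;
* `IsWindowed.hasDerivWithinAt_levRead` — **`dₜ F_m = −𝔅̃_m(F_{m+1}, F_{m+1})`** within `[0, T]`
  for `2 ≤ m`, `m + 1 < s` (`𝔅̃_m = bilExt` of `KatoLaiBilinearExt`);
* `IsWindowed.contDiffOn_levRead` — **`F_m ∈ C^l([0, T]; X)`** for `2 ≤ m`, `m + l + 1 ≤ s`? precisely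
  `m + l < s`.

Everything is proved; no named fact and no `sorry` is introduced.

## References

* T. Kato, C. Y. Lai, J. Funct. Anal. 56 (1984) 15–28, Thm I, §5–§6. [KatoLai1984]
-/

noncomputable section

open MeasureTheory Set Function Filter Topology TopologicalSpace
open scoped NNReal ENNReal InnerProductSpace RealInnerProductSpace

namespace Literature.Analysis.FluidPDE

open FunctionSpaces FunctionSpaces.Torus UnitAddTorus

namespace PeriodicCylinder

/-! ### The abstract tool -/

section Abstract

variable {X : Type*} [NormedAddCommGroup X] [InnerProductSpace ℝ X] [CompleteSpace X]

/-- Clamping to `[0, T]`. [folklore] -/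
def clampIcc (T : ℝ) (τ : ℝ) : ℝ := max 0 (min τ T)

/-- The clamp lands in `[0, T]` for `T ≥ 0`. [folklore] -/
theorem clampIcc_mem {T : ℝ} (hT : 0 ≤ T) (τ : ℝ) : clampIcc T τ ∈ Icc 0 T :=
  ⟨le_max_left _ _, max_le hT (min_le_right _ _)⟩

/-- The clamp is the identity on `[0, T]`. [folklore] -/
theorem clampIcc_of_mem {T τ : ℝ} (hτ : τ ∈ Icc 0 T) : clampIcc T τ = τ := by
  rw [clampIcc, min_eq_left hτ.2, max_eq_right hτ.1]

/-- The clamp is continuous. [folklore] -/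
theorem continuous_clampIcc (T : ℝ) : Continuous (clampIcc T) := continuous_const.max (continuous_id.min continuous_const)

/-- **Derivatives from a dense set of pairings**: if `Φ, b : [0, T] → X` are continuous and for
`v` in a dense set `dₜ ⟪v, Φ t⟫ = ⟪v, b t⟫` within `[0, T]`, then `Φ(t) − Φ(0) = ∫₀ᵗ b` and
`dₜ Φ = b` within `[0, T]`. [folklore] -/
theorem hasDerivWithinAt_of_dense_inner {Φ b : ℝ → X} {T : ℝ} (hT : 0 ≤ T) (hΦ : ContinuousOn Φ (Icc 0 T)) (hb : ContinuousOn b (Icc 0 T))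
    {D : Set X} (hD : Dense D) (h : ∀ v ∈ D, ∀ t ∈ Icc 0 T, HasDerivWithinAt (fun τ => ⟪v, Φ τ⟫_ℝ) ⟪v, b t⟫_ℝ (Icc 0 T) t) :
    ∀ t ∈ Icc 0 T, HasDerivWithinAt Φ (b t) (Icc 0 T) t := by
  set bb : ℝ → X := fun τ => b (clampIcc T τ) with hbb
  have hbbc : Continuous bb := hb.comp_continuous (continuous_clampIcc T) (clampIcc_mem hT)
  have hbb_of : ∀ {τ}, τ ∈ Icc 0 T → bb τ = b τ := fun hτ => by rw [hbb]; simp only; rw [clampIcc_of_mem hτ]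
  -- the integral identity
  have hint : ∀ t ∈ Icc 0 T, Φ t - Φ 0 = ∫ τ in (0 : ℝ)..t, bb τ := by
    intro t ht
    have key : ∀ v ∈ D, ⟪v, Φ t - Φ 0 - ∫ τ in (0 : ℝ)..t, bb τ⟫_ℝ = 0 := by
      intro v hv
      set F : ℝ → ℝ := fun τ => ⟪v, Φ τ⟫_ℝ - ∫ σ in (0 : ℝ)..τ, ⟪v, bb σ⟫_ℝ with hF
      have hci : Continuous fun σ => ⟪v, bb σ⟫_ℝ := continuous_const.inner hbbc
      have hFc : ContinuousOn F (Icc 0 T) :=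
        ((continuousOn_const.inner hΦ)).sub (intervalIntegral.continuous_primitive (fun a c => hci.intervalIntegrable a c) 0).continuousOn
      have hFd : ∀ x ∈ Ico 0 T, HasDerivWithinAt F 0 (Ici x) x := by
        intro x hx
        have hxI : x ∈ Icc 0 T := ⟨hx.1, hx.2.le⟩
        have h1 := h v hv x hxI
        have h2 : HasDerivAt (fun τ => ∫ σ in (0 : ℝ)..τ, ⟪v, bb σ⟫_ℝ) ⟪v, bb x⟫_ℝ x :=
          intervalIntegral.integral_hasDerivAt_right (hci.intervalIntegrable 0 x) hci.aestronglyMeasurable.stronglyMeasurableAtFilter hci.continuousAt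
        have h3 := h1.sub h2.hasDerivWithinAt
        rw [hbb_of hxI, sub_self] at h3
        exact h3.mono_of_mem_nhdsWithin (mem_of_superset (Icc_mem_nhdsGE hx.2) (Icc_subset_Icc hx.1 le_rfl))
      have hconst := constant_of_has_deriv_right_zero hFc hFd t ht
      simp only [hF, intervalIntegral.integral_same, sub_zero] at hconst
      have hii : ∫ σ in (0 : ℝ)..t, ⟪v, bb σ⟫_ℝ = ⟪v, ∫ σ in (0 : ℝ)..t, bb σ⟫_ℝ := by
        simp only [intervalIntegral.integral_of_le ht.1]
        exact integral_inner ((hbbc.integrableOn_Icc).mono_set Ioc_subset_Icc_self) v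
      rw [inner_sub_right, inner_sub_right, ← hii]
      linarith
    -- density
    set x := Φ t - Φ 0 - ∫ τ in (0 : ℝ)..t, bb τ with hx
    have hall : ∀ v : X, ⟪v, x⟫_ℝ = 0 := by
      intro v
      have hclosed : IsClosed {w : X | ⟪w, x⟫_ℝ = 0} := isClosed_eq (continuous_id.inner continuous_const) continuous_const
      have hsub : D ⊆ {w : X | ⟪w, x⟫_ℝ = 0} := fun w hw => key w hw
      have : (univ : Set X) ⊆ {w : X | ⟪w, x⟫_ℝ = 0} := by
        rw [← hD.closure_eq]; exact hclosed.closure_subset_iff.2 hsub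
      exact this (mem_univ v)
    have hx0 : x = 0 := inner_self_eq_zero.1 (hall x)
    rw [hx] at hx0
    exact (sub_eq_zero.1 hx0)
  -- the derivative
  intro t ht
  have hprim : HasDerivAt (fun τ => ∫ σ in (0 : ℝ)..τ, bb σ) (bb t) t :=
    intervalIntegral.integral_hasDerivAt_right (hbbc.intervalIntegrable 0 t) hbbc.aestronglyMeasurable.stronglyMeasurableAtFilter hbbc.continuousAt
  have h1 : HasDerivWithinAt (fun τ => Φ 0 + ∫ σ in (0 : ℝ)..τ, bb σ) (bb t) (Icc 0 T) t :=
    (hprim.hasDerivWithinAt (s := Icc 0 T)).const_add (Φ 0)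
  rw [hbb_of ht] at h1
  refine h1.congr (fun τ hτ => ?_) ?_
  · have := hint τ hτ; rw [sub_eq_iff_eq_add'] at this; exact this
  · have := hint t ht; rw [sub_eq_iff_eq_add'] at this; exact this

end Abstract

/-! ### Two-sided gluing within an interval -/

/-- A right neighbourhood and a left neighbourhood together are a neighbourhood within `[0, T]`:
continuity. [folklore] -/
theorem continuousWithinAt_Icc_of_sides {E : Type*} [TopologicalSpace E] {f : ℝ → E} {T t : ℝ} (ht : t ∈ Icc 0 T)
    (hR : t < T → ∃ η > 0, ContinuousWithinAt f (Icc t (t + η)) t)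
    (hL : 0 < t → ∃ η > 0, ContinuousWithinAt f (Icc (t - η) t) t) : ContinuousWithinAt f (Icc 0 T) t := by
  -- the union of the two one-sided sets is a neighbourhood of `t` within `Icc 0 T`
  rcases eq_or_lt_of_le ht.1 with h0 | h0
  · -- `t = 0`
    subst h0
    rcases eq_or_lt_of_le ht.2 with hT | hT
    · -- `T = 0`: the interval is a point
      subst hT; rw [Icc_self]; exact continuousWithinAt_singleton
    · obtain ⟨η, hη, hc⟩ := hR hT
      exact hc.mono_of_mem_nhdsWithin (nhdsWithin_mono _ Icc_subset_Ici_self (Icc_mem_nhdsGE (by linarith)))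
  · rcases eq_or_lt_of_le ht.2 with hT | hT
    · -- `t = T`
      obtain ⟨η, hη, hc⟩ := hL h0
      subst hT
      exact hc.mono_of_mem_nhdsWithin (nhdsWithin_mono _ Icc_subset_Iic_self (Icc_mem_nhdsLE (by linarith)))
    · obtain ⟨η, hη, hcR⟩ := hR hT
      obtain ⟨η', hη', hcL⟩ := hL h0
      have hu : ContinuousWithinAt f (Icc (t - η') t ∪ Icc t (t + η)) t := continuousWithinAt_union.2 ⟨hcL, hcR⟩
      refine hu.mono_of_mem_nhdsWithin ?_
      have : Icc (t - η') (t + η) ∈ 𝓝 t := Icc_mem_nhds (by linarith) (by linarith)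
      refine mem_of_superset (mem_nhdsWithin_of_mem_nhds this) fun x hx => ?_
      rcases le_total x t with h | h
      · exact Or.inl ⟨hx.1, h⟩
      · exact Or.inr ⟨h, hx.2⟩

/-- A right derivative and a left derivative together are a derivative within `[0, T]`. [folklore] -/
theorem hasDerivWithinAt_Icc_of_sides {E : Type*} [NormedAddCommGroup E] [NormedSpace ℝ E] {f : ℝ → E} {f' : E} {T t : ℝ}
    (ht : t ∈ Icc 0 T) (hT0 : 0 < T)
    (hR : t < T → ∃ η > 0, HasDerivWithinAt f f' (Icc t (t + η)) t)
    (hL : 0 < t → ∃ η > 0, HasDerivWithinAt f f' (Icc (t - η) t) t) : HasDerivWithinAt f f' (Icc 0 T) t := by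
  rcases eq_or_lt_of_le ht.1 with h0 | h0
  · subst h0
    obtain ⟨η, hη, hc⟩ := hR hT0
    exact hc.mono_of_mem_nhdsWithin (nhdsWithin_mono _ Icc_subset_Ici_self (Icc_mem_nhdsGE (by linarith)))
  · rcases eq_or_lt_of_le ht.2 with hT | hT
    · obtain ⟨η, hη, hc⟩ := hL h0
      subst hT
      exact hc.mono_of_mem_nhdsWithin (nhdsWithin_mono _ Icc_subset_Iic_self (Icc_mem_nhdsLE (by linarith)))
    · obtain ⟨η, hη, hcR⟩ := hR hT
      obtain ⟨η', hη', hcL⟩ := hL h0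
      have hu : HasDerivWithinAt f f' (Icc (t - η') t ∪ Icc t (t + η)) t := hcL.union hcR
      refine hu.mono_of_mem_nhdsWithin ?_
      have : Icc (t - η') (t + η) ∈ 𝓝 t := Icc_mem_nhds (by linarith) (by linarith)
      refine mem_of_superset (mem_nhdsWithin_of_mem_nhds this) fun x hx => ?_
      rcases le_total x t with h | h
      · exact Or.inl ⟨hx.1, h⟩
      · exact Or.inr ⟨h, hx.2⟩

/-! ### Reading a coefficient family at a level, as a function -/

open Classical in
/-- **The level-`p` reading** of `g ∈ X` (`0` if `g` has no level-`p` reading). [folklore] -/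
def levRead (p : ℕ) (g : SymL2 (Fin 3)) : SymL2 (Fin 3) :=
  if h : ∃ F, AtLevel p g F then Classical.choose h else 0

/-- The reading is the level-`p` reading when there is one. [folklore] -/
theorem AtLevel.levRead_eq {p : ℕ} {g F : SymL2 (Fin 3)} (h : AtLevel p g F) : levRead p g = F := by
  have hex : ∃ F, AtLevel p g F := ⟨F, h⟩
  unfold levRead
  rw [dif_pos hex]
  exact (Classical.choose_spec hex).unique h

/-- `⟪drop j w, F⟫ = ⟪w, drop j F⟫`. [folklore] -/
theorem inner_drop_left (j : ℕ) (w F : SymL2 (Fin 3)) : ⟪drop j w, F⟫_ℝ = ⟪w, drop j F⟫_ℝ := by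
  refine (SymL2.hasSum_inner (drop j w) F).unique ((SymL2.hasSum_inner w (drop j F)).congr_fun fun k => ?_)
  rw [drop_apply, drop_apply, inner_smul_left, inner_smul_right, map_inv₀, Complex.conj_ofReal]

/-- `drop m F = g` when `F` is `g` at level `m`. [folklore] -/
theorem drop_eq_of_atLevel {m : ℕ} {g F : SymL2 (Fin 3)} (h : AtLevel m g F) : drop m F = g := by
  have h1 : AtLevel 0 g (drop m F) := AtLevel.drop (p := 0) (j := m) (by rwa [zero_add])
  exact h1.unique (atLevel_zero g)

/-! ### Windowed paths -/

section Windowed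

variable {L : ℝ} (hL : 0 < L) (s : ℕ) (δ T : ℝ) (G : ℝ → SymL2 (Fin 3))

/-- **A windowed coefficient path**: every `t ∈ [0, T)` lies in the interior-or-left of a window
`[tw, tw + δ]` on which `G = i ∘ u (· − tw)` for a solution in duality form `u` of the level-`s`
problem, and every `t ∈ (0, T]` in the interior-or-right of such a window. [cite: KatoLai1984, §6] -/
structure IsWindowed : Prop where
  /-- positive window length -/
  hδ : 0 < δ
  /-- positive final time -/
  hT : 0 < T
  /-- windows to the right -/
  right : ∀ t ∈ Ico 0 T, ∃ (ε tw : ℝ) (φ : SymL2 (Fin 3)) (u : ℝ → SymL2 (Fin 3)), ε ≠ 0 ∧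
    KatoLai.IsFormSolution (embed s ε) (klForm hL s ε) φ δ u ∧ tw ≤ t ∧ t < tw + δ ∧ ∀ τ ∈ Icc 0 δ, G (tw + τ) = embed s ε (u τ)
  /-- windows to the left -/
  left : ∀ t ∈ Ioc 0 T, ∃ (ε tw : ℝ) (φ : SymL2 (Fin 3)) (u : ℝ → SymL2 (Fin 3)), ε ≠ 0 ∧
    KatoLai.IsFormSolution (embed s ε) (klForm hL s ε) φ δ u ∧ tw < t ∧ t ≤ tw + δ ∧ ∀ τ ∈ Icc 0 δ, G (tw + τ) = embed s ε (u τ)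

end Windowed

section Reg

variable {L : ℝ} {hL : 0 < L} {s : ℕ} {δ T : ℝ} {G : ℝ → SymL2 (Fin 3)} (hW : IsWindowed hL s δ T G)
include hW

/-- Every `t ∈ [0, T]` lies in some window. [folklore] -/
theorem IsWindowed.exists_window {t : ℝ} (ht : t ∈ Icc 0 T) : ∃ (ε tw : ℝ) (φ : SymL2 (Fin 3)) (u : ℝ → SymL2 (Fin 3)), ε ≠ 0 ∧
    KatoLai.IsFormSolution (embed s ε) (klForm hL s ε) φ δ u ∧ tw ≤ t ∧ t ≤ tw + δ ∧ ∀ τ ∈ Icc 0 δ, G (tw + τ) = embed s ε (u τ) := by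
  rcases lt_or_eq_of_le ht.2 with hlt | heq
  · obtain ⟨ε, tw, φ, u, hε, hu, h1, h2, h3⟩ := hW.right t ⟨ht.1, hlt⟩
    exact ⟨ε, tw, φ, u, hε, hu, h1, h2.le, h3⟩
  · obtain ⟨ε, tw, φ, u, hε, hu, h1, h2, h3⟩ := hW.left t ⟨by rw [heq]; exact hW.hT, ht.2⟩
    exact ⟨ε, tw, φ, u, hε, hu, h1.le, h2, h3⟩

omit hW in
/-- On a window, the level-`p` reading (`p ≤ s`) is `levelOf p (u (t − tw))`. [folklore] -/
theorem IsWindowed.levRead_eq_levelOf {p : ℕ} (hp : p ≤ s) (hs1 : 1 ≤ s) {ε tw : ℝ} (hε : ε ≠ 0) {u : ℝ → SymL2 (Fin 3)}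
    (hG : ∀ τ ∈ Icc 0 δ, G (tw + τ) = embed s ε (u τ)) {t : ℝ} (ht : t - tw ∈ Icc 0 δ) :
    levRead p (G t) = levelOf s hε hp hs1 (u (t - tw)) := by
  have h := hG (t - tw) ht
  rw [show tw + (t - tw) = t by ring] at h
  rw [h]
  exact (atLevel_embed_levelOf s hε hp hs1 (u (t - tw))).levRead_eq

/-- **Continuity of the level readings below the top level.** [cite: KatoLai1984, Thm I] -/
theorem IsWindowed.continuousOn_levRead {p : ℕ} (hp : p < s) : ContinuousOn (fun t => levRead p (G t)) (Icc 0 T) := by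
  have hps : p ≤ s := hp.le
  have hs1 : 1 ≤ s := by omega
  intro t ht
  refine continuousWithinAt_Icc_of_sides ht (fun hlt => ?_) (fun h0 => ?_)
  · obtain ⟨ε, tw, φ, u, hε, hu, h1, h2, hG⟩ := hW.right t ⟨ht.1, hlt⟩
    refine ⟨tw + δ - t, by linarith, ?_⟩
    have hc := continuousOn_levelOf_sol s hL hε hps hs1 hp hu
    have hmaps : MapsTo (fun t' : ℝ => t' - tw) (Icc t (t + (tw + δ - t))) (Icc 0 δ) := fun t' ht' => ⟨by linarith [ht'.1], by linarith [ht'.2]⟩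
    have hcomp : ContinuousWithinAt (fun t' => levelOf s hε hps hs1 (u (t' - tw))) (Icc t (t + (tw + δ - t))) t :=
      (hc.comp (continuous_id.sub continuous_const).continuousOn hmaps) t ⟨le_rfl, by linarith⟩
    refine hcomp.congr (fun t' ht' => ?_) ?_
    · exact IsWindowed.levRead_eq_levelOf hps hs1 hε hG (hmaps ht')
    · exact IsWindowed.levRead_eq_levelOf hps hs1 hε hG (hmaps ⟨le_rfl, by linarith⟩)
  · obtain ⟨ε, tw, φ, u, hε, hu, h1, h2, hG⟩ := hW.left t ⟨h0, ht.2⟩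
    refine ⟨t - tw, by linarith, ?_⟩
    have hc := continuousOn_levelOf_sol s hL hε hps hs1 hp hu
    have hmaps : MapsTo (fun t' : ℝ => t' - tw) (Icc (t - (t - tw)) t) (Icc 0 δ) := fun t' ht' => ⟨by linarith [ht'.1], by linarith [ht'.2]⟩
    have hcomp : ContinuousWithinAt (fun t' => levelOf s hε hps hs1 (u (t' - tw))) (Icc (t - (t - tw)) t) t :=
      (hc.comp (continuous_id.sub continuous_const).continuousOn hmaps) t ⟨by linarith, le_rfl⟩
    refine hcomp.congr (fun t' ht' => ?_) ?_
    · exact IsWindowed.levRead_eq_levelOf hps hs1 hε hG (hmaps ht')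
    · exact IsWindowed.levRead_eq_levelOf hps hs1 hε hG (hmaps ⟨by linarith, le_rfl⟩)

/-- **The pairings of `G` are differentiable**: `dₜ ⟪w, G t⟫ = −⟪w, drop m (𝔅̃_m (F⁺, F⁺))⟫` with
`F⁺ = levRead (m+1) (G t)`, within `[0, T]` (`2 ≤ m`, `m + 1 ≤ s`). [cite: KatoLai1984, §5 (5.6)] -/
theorem IsWindowed.hasDerivWithinAt_inner {m : ℕ} (hm : 2 ≤ m) (hms : m + 1 ≤ s) (w : SymL2 (Fin 3)) {t : ℝ} (ht : t ∈ Icc 0 T) :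
    HasDerivWithinAt (fun τ => ⟪w, G τ⟫_ℝ)
      (-⟪w, drop m (bilExt hL hm (levRead (m + 1) (G t)) (levRead (m + 1) (G t)))⟫_ℝ) (Icc 0 T) t := by
  have hs1 : 1 ≤ s := by omega
  -- the derivative value on a window through `t`
  have hval : ∀ {ε tw : ℝ} (hε : ε ≠ 0) {φ : SymL2 (Fin 3)} {u : ℝ → SymL2 (Fin 3)}, KatoLai.IsFormSolution (embed s ε) (klForm hL s ε) φ δ u →
      (∀ τ ∈ Icc 0 δ, G (tw + τ) = embed s ε (u τ)) → t - tw ∈ Icc 0 δ →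
      -⟪klOpExt hL s ε (u (t - tw)), w⟫_ℝ = -⟪w, drop m (bilExt hL hm (levRead (m + 1) (G t)) (levRead (m + 1) (G t)))⟫_ℝ := by
    intro ε tw hε φ u hu hG htw
    rw [IsWindowed.levRead_eq_levelOf hms hs1 hε hG htw, drop_eq_of_atLevel (atLevel_klOpExt_bilExt hL hm hε hms hs1 (u (t - tw))), real_inner_comm]
  -- one-sided derivatives from the windows
  have hside : ∀ {ε tw : ℝ} (hε : ε ≠ 0) {φ : SymL2 (Fin 3)} {u : ℝ → SymL2 (Fin 3)} (hu : KatoLai.IsFormSolution (embed s ε) (klForm hL s ε) φ δ u)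
      (hG : ∀ τ ∈ Icc 0 δ, G (tw + τ) = embed s ε (u τ)) (htw : t - tw ∈ Icc 0 δ),
      HasDerivWithinAt (fun τ => ⟪w, G τ⟫_ℝ) (-⟪w, drop m (bilExt hL hm (levRead (m + 1) (G t)) (levRead (m + 1) (G t)))⟫_ℝ) (Icc tw (tw + δ)) t := by
    intro ε tw hε φ u hu hG htw
    have hd := hasDerivWithinAt_inner_klVel hL s ε hu w htw
    have hsh : HasDerivWithinAt (fun t' : ℝ => t' - tw) 1 (Icc tw (tw + δ)) t := by
      simpa using ((hasDerivAt_id t).sub_const tw).hasDerivWithinAt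
    have hmaps : MapsTo (fun t' : ℝ => t' - tw) (Icc tw (tw + δ)) (Icc 0 δ) := fun t' ht' => ⟨by linarith [ht'.1], by linarith [ht'.2]⟩
    have hcomp := hd.comp t hsh hmaps
    rw [mul_one, hval hε hu hG htw] at hcomp
    refine hcomp.congr (fun t' ht' => ?_) ?_
    · have h := hG (t' - tw) (hmaps ht')
      rw [show tw + (t' - tw) = t' by ring] at h
      show ⟪w, G t'⟫_ℝ = ⟪w, klVel s ε u (t' - tw)⟫_ℝ
      rw [h]; rfl
    · have h := hG (t - tw) htw
      rw [show tw + (t - tw) = t by ring] at h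
      show ⟪w, G t⟫_ℝ = ⟪w, klVel s ε u (t - tw)⟫_ℝ
      rw [h]; rfl
  refine hasDerivWithinAt_Icc_of_sides ht hW.hT (fun hlt => ?_) (fun h0 => ?_)
  · obtain ⟨ε, tw, φ, u, hε, hu, h1, h2, hG⟩ := hW.right t ⟨ht.1, hlt⟩
    refine ⟨tw + δ - t, by linarith, ?_⟩
    have h := hside hε hu hG ⟨by linarith, by linarith⟩
    rw [show t + (tw + δ - t) = tw + δ by ring]
    exact h.mono (Icc_subset_Icc h1 le_rfl)
  · obtain ⟨ε, tw, φ, u, hε, hu, h1, h2, hG⟩ := hW.left t ⟨h0, ht.2⟩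
    refine ⟨t - tw, by linarith, ?_⟩
    have h := hside hε hu hG ⟨by linarith, by linarith⟩
    rw [show t - (t - tw) = tw by ring]
    exact h.mono (Icc_subset_Icc le_rfl h2)

/-- **The derivative of the level readings**: `dₜ F_m = −𝔅̃_m (F_{m+1}, F_{m+1})` within `[0, T]`
for `2 ≤ m`, `m + 1 < s`. [cite: KatoLai1984, Thm I, §5] -/
theorem IsWindowed.hasDerivWithinAt_levRead {m : ℕ} (hm : 2 ≤ m) (hms : m + 1 < s) {t : ℝ} (ht : t ∈ Icc 0 T) :
    HasDerivWithinAt (fun τ => levRead m (G τ))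
      (-bilExt hL hm (levRead (m + 1) (G t)) (levRead (m + 1) (G t))) (Icc 0 T) t := by
  have hms' : m + 1 ≤ s := hms.le
  have hΦ : ContinuousOn (fun τ => levRead m (G τ)) (Icc 0 T) := hW.continuousOn_levRead (by omega)
  have hF : ContinuousOn (fun τ => levRead (m + 1) (G τ)) (Icc 0 T) := hW.continuousOn_levRead hms
  have hb : ContinuousOn (fun τ => -bilExt hL hm (levRead (m + 1) (G τ)) (levRead (m + 1) (G τ))) (Icc 0 T) :=
    ((bilExt hL hm).continuous₂.comp_continuousOn (hF.prodMk hF)).neg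
  have hD : Dense (range (drop m)) := (SymL2.denseRange_diag (abs_wt_inv_le m) (wt_inv_neg m) fun k => (inv_pos.2 (wt_pos m k)).ne').closure_eq ▸
    dense_univ |> fun h => by
      have := SymL2.denseRange_diag (abs_wt_inv_le m) (wt_inv_neg m) fun k => (inv_pos.2 (wt_pos m k)).ne'
      exact this
  refine hasDerivWithinAt_of_dense_inner hW.hT.le hΦ hb hD (fun v hv τ hτ => ?_) t ht
  obtain ⟨w, rfl⟩ := hv
  -- `⟪drop m w, F_m τ⟫ = ⟪w, G τ⟫` on `[0, T]`
  have heq : ∀ σ ∈ Icc 0 T, ⟪drop m w, levRead m (G σ)⟫_ℝ = ⟪w, G σ⟫_ℝ := by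
    intro σ hσ
    obtain ⟨ε, tw, φ, u, hε, hu, h1, h2, hG⟩ := hW.exists_window hσ
    have hs1 : 1 ≤ s := by omega
    rw [inner_drop_left, IsWindowed.levRead_eq_levelOf (by omega : m ≤ s) hs1 hε hG ⟨by linarith, by linarith⟩,
      drop_eq_of_atLevel (atLevel_embed_levelOf s hε (by omega : m ≤ s) hs1 (u (σ - tw)))]
    have h := hG (σ - tw) ⟨by linarith, by linarith⟩
    rw [show tw + (σ - tw) = σ by ring] at h
    rw [h]
  have hd := hW.hasDerivWithinAt_inner hm hms' w hτ
  rw [← inner_drop_left, ← inner_neg_right] at hd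
  exact hd.congr (fun σ hσ => heq σ hσ) (heq τ hτ)

/-- The derivative identifies `derivWithin`. [folklore] -/
theorem IsWindowed.derivWithin_levRead {m : ℕ} (hm : 2 ≤ m) (hms : m + 1 < s) {t : ℝ} (ht : t ∈ Icc 0 T) :
    derivWithin (fun τ => levRead m (G τ)) (Icc 0 T) t = -bilExt hL hm (levRead (m + 1) (G t)) (levRead (m + 1) (G t)) :=
  (hW.hasDerivWithinAt_levRead hm hms ht).derivWithin (uniqueDiffOn_Icc hW.hT t ht)

/-- **Time regularity of the level readings**: `F_m ∈ C^l([0, T]; X)` for `2 ≤ m` and `m + l < s`.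
[cite: KatoLai1984, Thm I, §5–§6] -/
theorem IsWindowed.contDiffOn_levRead : ∀ (l : ℕ) {m : ℕ}, 2 ≤ m → m + l < s →
    ContDiffOn ℝ l (fun τ => levRead m (G τ)) (Icc 0 T)
  | 0, m, _, hml => by
    rw [show ((0 : ℕ) : WithTop ℕ∞) = 0 from rfl, contDiffOn_zero]
    exact hW.continuousOn_levRead (by omega)
  | l + 1, m, hm, hml => by
    have hms : m + 1 < s := by omega
    rw [show (((l + 1 : ℕ) : WithTop ℕ∞)) = (l : WithTop ℕ∞) + 1 by push_cast; rfl,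
      contDiffOn_succ_iff_derivWithin (uniqueDiffOn_Icc hW.hT)]
    refine ⟨fun t ht => (hW.hasDerivWithinAt_levRead hm hms ht).differentiableWithinAt, fun h => absurd h (by simp), ?_⟩
    have ih : ContDiffOn ℝ l (fun τ => levRead (m + 1) (G τ)) (Icc 0 T) := IsWindowed.contDiffOn_levRead l (by omega) (by omega)
    have hb : ContDiffOn ℝ l (fun τ => -bilExt hL hm (levRead (m + 1) (G τ)) (levRead (m + 1) (G τ))) (Icc 0 T) :=
      ((bilExt hL hm).isBoundedBilinearMap.contDiff.comp_contDiffOn (ih.prodMk ih)).neg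
    exact hb.congr fun t ht => hW.derivWithin_levRead hm hms ht

end Reg

end PeriodicCylinder

end Literature.Analysis.FluidPDE
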